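import Mathlib
import Literature.Analysis.FluidPDE.ClassicalSolution
import Literature.Analysis.FluidPDE.BKMClassVorticityTimeLipschitz
import Literature.Analysis.FluidPDE.VorticityCalculus
import Literature.Analysis.FluidPDE.VorticityStretching
import Literature.Analysis.FluidPDE.LocalBiotSavartCalculus
import Literature.Analysis.FluidPDE.NewtonKernel
import Summits.NavierStokesRegularity.NavierStokesRegularity.Theorems.ThreadingFluxCentreJetDriftLaw
import HarnessLib

/-!
# Crux `PoloidalLiouville` (stmt-NavierStokesRegularity-1222, wall W1), crux idea «steady-centre-sieve» (ns-idea-15 g5,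
# `Cruxes/PoloidalLiouville/CentreJetSketch.lean`): the CENTRE DRIFT LAW ALONG AN UNTHREADED EVOLUTION (E2′), body VERBATIM

Support file (Theorems-side; seat ns-wall-eng-7 g4, cell ns-wall-extremal, W1 adjunct; `--supports
stmt-NavierStokesRegularity-1222 --as helper`).  (E2′, S): along a classical Navier–Stokes evolution (`ν = 1`, no force) on
`[t₀, t₁)` that is unthreaded about `x₀` at every time of the window, `u(t, x₀) × Δu(t, x₀) = 0` for every `t ∈ [t₀, t₁)`.

Proof: at each time the slice is unthreaded, so by (E1) `ω(t, x₀) = 0`, `∇ω(t, x₀)` is skew and `Δω(t, x₀) = 0`; the vorticity at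
the centre vanishes identically in time, hence its (one-sided, within `[t₀,t₁)`) time derivative vanishes, and `∂ₜ` commutes with
`curl` for jointly smooth fields (Literature `IsSmoothSpaceTimeOn.hasDerivWithinAt_curl_slice`); the curl of the momentum equation
at `x₀` then reduces, exactly as in the steady case (`CentreJet.centreDriftLaw`), to `∇ω(x₀)[u(x₀)] = 0`, and the skew-to-cross
lemma `apply_eq_half_cross_curlCLM_of_skew` with `curl ω = −Δu` gives the law.

* `CentreJet.centreDriftLawEvolution` — body of the sketch's `CentreDriftLawEvolution` verbatim (`IsUnthreadedAbout x₀ (u t)` unfolded).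

HONEST LABEL: an elementary consequence of the vorticity equation at one point, about typed objects of one crux idea; the card's
conjectures and target, `PoloidalLiouville` (1222) and NS regularity remain OPEN and untouched; information-grade (movement 0).
[cite: MajdaBertozziCUP2002, §1.1 (vector identities)]
-/

-- the summit and its single problem share the name (D-0017 nested layout)
set_option linter.dupNamespace false

noncomputable section

open Set Function
open scoped RealInnerProductSpace
open Literature.Analysis.FluidPDE

namespace Summit.NavierStokesRegularity.NavierStokesRegularity.Theorems.PoloidalLiouville.CentreJet

/-- ★ **(E2′) `CentreDriftLawEvolution`, body verbatim**: along an unthreaded classical evolution on `[t₀, t₁)`,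
`u(t, x₀) × Δu(t, x₀) = 0` for every `t ∈ [t₀, t₁)`. -/
theorem centreDriftLawEvolution :
    ∀ (u : ℝ → EuclideanSpace ℝ (Fin 3) → EuclideanSpace ℝ (Fin 3)) (p : ℝ → EuclideanSpace ℝ (Fin 3) → ℝ)
      (x₀ : EuclideanSpace ℝ (Fin 3)) (t₀ t₁ : ℝ), t₀ < t₁ →
      IsClassicalNSSolutionOn (Ico t₀ t₁) 1 0 u p →
      (∀ t ∈ Ico t₀ t₁, ∀ x, inner ℝ (x - x₀) (curl (u t) x) = 0) →
      ∀ t ∈ Ico t₀ t₁, cross (u t x₀) (Laplacian.laplacian (u t) x₀) = 0 := by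
  intro u p x₀ t₀ t₁ ht hsol hun t htS
  set S : Set ℝ := Ico t₀ t₁ with hSdef
  have hS : UniqueDiffOn ℝ S := uniqueDiffOn_Ico t₀ t₁
  have hcl : S ⊆ closure (interior S) := by
    rw [hSdef, interior_Ico, closure_Ioo ht.ne]
    exact Ico_subset_Icc_self
  -- smoothness of the slice and of the pressure slice
  have hV3 : ContDiff ℝ 3 (u t) := (hsol.contDiff_velocity htS).of_le (by norm_cast)
  have hV2 : ContDiff ℝ 2 (u t) := hV3.of_le (by norm_num)
  have hq2 : ContDiff ℝ 2 (p t) := (hsol.contDiff_pressure htS).of_le (by norm_cast)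
  have hdf : VectorCalculus.IsDivFree (u t) := hsol.divFree t htS
  obtain ⟨hω0, hskew, hΔω⟩ := centreVorticityJet (u t) x₀ hV3 (hun t htS)
  -- `∂ₜ (curl u)(x₀) = 0`: the centre vorticity vanishes at all times of the window
  have hder : HasDerivWithinAt (fun s => curl (u s) x₀) (curl (timeDerivWithin S u t) x₀) S t :=
    hsol.smooth_velocity.hasDerivWithinAt_curl_slice hS hcl htS x₀
  have hzero : HasDerivWithinAt (fun s => curl (u s) x₀) (0 : EuclideanSpace ℝ (Fin 3)) S t := by
    have hvan : ∀ s ∈ S, curl (u s) x₀ = (fun _ : ℝ => (0 : EuclideanSpace ℝ (Fin 3))) s := fun s hs =>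
      (centreVorticityJet (u s) x₀ ((hsol.contDiff_velocity hs).of_le (by norm_cast)) (hun s hs)).1
    exact (hasDerivWithinAt_const t S (0 : EuclideanSpace ℝ (Fin 3))).congr_of_mem hvan htS
  have hcurl_dt : curl (timeDerivWithin S u t) x₀ = 0 := (hS t htS).eq_deriv _ hder hzero
  -- the players of the momentum equation
  have hΔV1 : ContDiff ℝ 1 (Laplacian.laplacian (u t)) := contDiff_laplacian (n := 1) (by exact_mod_cast hV3)
  have hDV2 : ContDiff ℝ 2 (fderiv ℝ (u t)) := hV3.fderiv_right (m := 2) (by norm_num)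
  have hconv1 : ContDiff ℝ 1 (fun x => fderiv ℝ (u t) x (u t x)) :=
    (hDV2.of_le (by norm_num)).clm_apply (hV3.of_le (by norm_num))
  have hgq1 : ContDiff ℝ 1 (gradient (p t)) :=
    (InnerProductSpace.toDual ℝ (EuclideanSpace ℝ (Fin 3))).symm.contDiff.comp (hq2.fderiv_right (m := 1) (by norm_num))
  -- `∂ₜu = Δu − ∇p − (u·∇)u` as functions of `x`
  have hA : timeDerivWithin S u t
      = fun x => (Laplacian.laplacian (u t) x - gradient (p t) x) - fderiv ℝ (u t) x (u t x) := by
    funext x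
    have h := hsol.momentum t htS x
    simp only [convect_apply, one_smul, Pi.zero_apply, add_zero] at h
    exact eq_sub_of_add_eq h
  -- curl of it at `x₀`
  have hAv : fderiv ℝ (curl (u t)) x₀ (u t x₀) = 0 := by
    have h := hcurl_dt
    rw [hA, curl_sub (((hΔV1.sub hgq1).differentiable one_ne_zero) x₀) ((hconv1.differentiable one_ne_zero) x₀),
      curl_sub ((hΔV1.differentiable one_ne_zero) x₀) ((hgq1.differentiable one_ne_zero) x₀),
      curl_gradient_eq_zero_holds _ hq2 x₀, curl_laplacian hV3 x₀, hΔω] at h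
    have hconv := curl_convect_self hV2 x₀
    simp only [convect_apply, hω0, map_zero, smul_zero, sub_zero, add_zero] at hconv
    rw [show (fun x => fderiv ℝ (u t) x (u t x)) = convect (u t) (u t) from rfl, hconv] at h
    simpa using h
  -- skew ⇒ cross, `curl ω = −Δu`
  have hrepr := apply_eq_half_cross_curlCLM_of_skew (fderiv ℝ (curl (u t)) x₀) hskew (u t x₀)
  rw [hAv, ← curl_eq_curlCLM, curl_curl_eq_neg_laplacian hV2 hdf x₀] at hrepr
  have h2 : cross (-(Laplacian.laplacian (u t)) x₀) (u t x₀) = 0 := by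
    have h := hrepr.symm
    rwa [smul_eq_zero, or_iff_right (by norm_num : ¬ (1 / 2 : ℝ) = 0)] at h
  have h3 : cross (u t x₀) (Laplacian.laplacian (u t) x₀) = cross (-(Laplacian.laplacian (u t)) x₀) (u t x₀) := by
    ext i
    fin_cases i <;> (simp [cross, cross_apply]; try ring)
  rw [h3, h2]

end Summit.NavierStokesRegularity.NavierStokesRegularity.Theorems.PoloidalLiouville.CentreJet

end
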